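import Literature.IUT.LogVolume.Corollary22ThetaClosureField
import Literature.NumberTheory.EllipticCurves.VariableChangePointsMap
import HarnessLib

/-!
# The theta closure field `F‡`: the anharmonic ORBIT of `λ` is «good»

Mochizuki, *Inter-universal Teichmüller theory IV*, Thm. 1.10, p. 22 ("`F = … := F_tpd(√−1, E_{F_tpd}[3·5])`") with
[IUTchI] Def. 3.1 (b) ("`F` is Galois over `F_mod`"); the cell's repair F‡ = `F_tpd(√−1, √λ, √(λ−1), E_λ[3·5])`
(`Corollary22ThetaClosureField.lean`, abc-iut-plan 2026-08-26T02:59:03Z). First half of the proof that `F‡` is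
Galois over `F_mod` (sequel `Corollary22ThetaClosureGalois.lean`), proof-only:

* `variableChange_legendre_one_sub` / `variableChange_legendre_inv` — the explicit changes of variables
  `(√−1, 1, 0, 0) • E_μ = E_{1−μ}` and `(√μ, 0, 0, 0) • E_μ = E_{1/μ}` of the Legendre family (the anharmonic
  generators; the general twist statements are abc-iut-c312-8's `LegendreAnharmonicTwistProofs`);
* «`μ` is GOOD» (inline conjunction): both square roots of `μ` and of `μ − 1` lie in `F‡` and so do the coordinates
  of every `15`-torsion point of `E_μ : y² = x(x−1)(x−μ)` over `F̄_tpd`; `good_lambda` (construction of `F‡`),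
  `coords_mem_of_variableChange` (transport along a change of variables with entries in `F‡`, by
  `VariableChange.pointEquiv`), `good_one_sub`, `good_inv`, and **`good_of_mem_anharmonicSet`**: every member of
  `{λ, 1/λ, 1−λ, 1/(1−λ), λ/(λ−1), (λ−1)/λ}` is good.

Classical; kernel-checked; TAKES NO SIDE on [IUTchIII] Cor. 3.12. IUT quotations carry
[claim: Mochizuki2012, status: disputed]; every declaration here is a proved theorem.
-/

noncomputable section

open scoped Classical

namespace Literature.IUT.LogVolume

namespace Cor22

open NumberField IsDedekindDomain Literature.NumberTheory.DiophantineGeometry.GenEll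
open Literature.NumberTheory.EllipticCurves WeierstrassCurve IntermediateField Field

variable (P : NFPoint)

/-! ## The two variable changes of the anharmonic group on the Legendre family -/

section Anharmonic

variable {L : Type} [Field L]

/-- **`E_{1−μ} ≅ E_μ^{(−1)}`**: for `i² = −1` the change of variables `(u, r, s, t) = (i, 1, 0, 0)` carries
`y² = x(x−1)(x−μ)` to `y² = x(x−1)(x−(1−μ))` (`x ↦ 1 − x`, `y ↦ i·y`). [cite: MochizukiGenEll2010, Rmk 4.4.2 p.24] -/
theorem variableChange_legendre_one_sub (μ : L) {i : L} (hi : i ^ 2 = -1) :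
    (⟨Units.mk0 i (by intro h; rw [h] at hi; norm_num at hi), 1, 0, 0⟩ : VariableChange L) •
        (⟨0, -(1 + μ), 0, μ, 0⟩ : WeierstrassCurve L) = ⟨0, -(1 + (1 - μ)), 0, 1 - μ, 0⟩ := by
  have hi2 : i⁻¹ ^ 2 = -1 := by rw [inv_pow, hi]; norm_num
  have hi4 : i⁻¹ ^ 4 = 1 := by rw [show (4 : ℕ) = 2 * 2 by norm_num, pow_mul, hi2]; norm_num
  have hi6 : i⁻¹ ^ 6 = -1 := by rw [show (6 : ℕ) = 2 * 3 by norm_num, pow_mul, hi2]; norm_num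
  ext
  · rw [variableChange_a₁, Units.val_inv_eq_inv_val, Units.val_mk0]
    show i⁻¹ * (0 + 2 * 0) = 0
    ring
  · rw [variableChange_a₂, Units.val_inv_eq_inv_val, Units.val_mk0]
    show i⁻¹ ^ 2 * (-(1 + μ) - 0 * 0 + 3 * 1 - 0 ^ 2) = -(1 + (1 - μ))
    rw [hi2]; ring
  · rw [variableChange_a₃, Units.val_inv_eq_inv_val, Units.val_mk0]
    show i⁻¹ ^ 3 * (0 + 1 * 0 + 2 * 0) = 0
    ring
  · rw [variableChange_a₄, Units.val_inv_eq_inv_val, Units.val_mk0]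
    show i⁻¹ ^ 4 * (μ - 0 * 0 + 2 * 1 * (-(1 + μ)) - (0 + 1 * 0) * 0 + 3 * 1 ^ 2 - 2 * 0 * 0) = 1 - μ
    rw [hi4]; ring
  · rw [variableChange_a₆, Units.val_inv_eq_inv_val, Units.val_mk0]
    show i⁻¹ ^ 6 * (0 + 1 * μ + 1 ^ 2 * (-(1 + μ)) + 1 ^ 3 - 0 * 0 - 0 ^ 2 - 1 * 0 * 0) = 0
    ring

/-- **`E_{1/μ} ≅ E_μ^{(μ)}`**: for `w² = μ ≠ 0` the change of variables `(u, r, s, t) = (w, 0, 0, 0)` carries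
`y² = x(x−1)(x−μ)` to `y² = x(x−1)(x−1/μ)` (`x ↦ x/μ`, `y ↦ y/(μw)`). [cite: MochizukiGenEll2010, Rmk 4.4.2 p.24] -/
theorem variableChange_legendre_inv (μ : L) {w : L} (hw : w ^ 2 = μ) (hμ : μ ≠ 0) :
    (⟨Units.mk0 w (by intro h; rw [h] at hw; exact hμ (by rw [← hw]; norm_num)), 0, 0, 0⟩ :
        VariableChange L) • (⟨0, -(1 + μ), 0, μ, 0⟩ : WeierstrassCurve L) = ⟨0, -(1 + μ⁻¹), 0, μ⁻¹, 0⟩ := by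
  have hw2 : w⁻¹ ^ 2 = μ⁻¹ := by rw [inv_pow, hw]
  have hw4 : w⁻¹ ^ 4 = μ⁻¹ ^ 2 := by rw [show (4 : ℕ) = 2 * 2 by norm_num, pow_mul, hw2]
  ext
  · rw [variableChange_a₁, Units.val_inv_eq_inv_val, Units.val_mk0]
    show w⁻¹ * (0 + 2 * 0) = 0
    ring
  · rw [variableChange_a₂, Units.val_inv_eq_inv_val, Units.val_mk0]
    show w⁻¹ ^ 2 * (-(1 + μ) - 0 * 0 + 3 * 0 - 0 ^ 2) = -(1 + μ⁻¹)
    rw [hw2]; field_simp; ring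
  · rw [variableChange_a₃, Units.val_inv_eq_inv_val, Units.val_mk0]
    show w⁻¹ ^ 3 * (0 + 0 * 0 + 2 * 0) = 0
    ring
  · rw [variableChange_a₄, Units.val_inv_eq_inv_val, Units.val_mk0]
    show w⁻¹ ^ 4 * (μ - 0 * 0 + 2 * 0 * (-(1 + μ)) - (0 + 0 * 0) * 0 + 3 * 0 ^ 2 - 2 * 0 * 0) = μ⁻¹
    rw [hw4]; field_simp; ring
  · rw [variableChange_a₆, Units.val_inv_eq_inv_val, Units.val_mk0]
    show w⁻¹ ^ 6 * (0 + 0 * μ + 0 ^ 2 * (-(1 + μ)) + 0 ^ 3 - 0 * 0 - 0 ^ 2 - 0 * 0 * 0) = 0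
    ring

end Anharmonic

/-! ## Notation-free statement of the orbit property

For `μ ∈ F̄_tpd` we say (inline, as a conjunction) that `μ` is GOOD when every square root of `μ` and of `μ − 1`
lies in `F‡` and the coordinates of every `15`-torsion point of `y² = x(x−1)(x−μ)` over `F̄_tpd` lie in `F‡`. -/

section Orbit

/-- Every square root of `−1` in `F̄_tpd` lies in `F‡`. [claim: Mochizuki2012, status: disputed] -/
theorem sqrt_neg_one_mem {z : AlgebraicClosure P.F} (hz : z ^ 2 = -1) : z ∈ thetaClosureField P := by
  refine sqrt_mem_thetaClosureField P (a := -1) (by simp [thetaClosureRadicands]) ?_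
  rw [map_neg, map_one]; exact hz

/-- Every square root of `λ` in `F̄_tpd` lies in `F‡`. [claim: Mochizuki2012, status: disputed] -/
theorem sqrt_lambda_mem {z : AlgebraicClosure P.F} (hz : z ^ 2 = algebraMap P.F (AlgebraicClosure P.F) P.x) :
    z ∈ thetaClosureField P :=
  sqrt_mem_thetaClosureField P (a := P.x) (by simp [thetaClosureRadicands]) hz

/-- Every square root of `λ − 1` in `F̄_tpd` lies in `F‡`. [claim: Mochizuki2012, status: disputed] -/
theorem sqrt_lambda_sub_one_mem {z : AlgebraicClosure P.F}
    (hz : z ^ 2 = algebraMap P.F (AlgebraicClosure P.F) P.x - 1) : z ∈ thetaClosureField P := by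
  refine sqrt_mem_thetaClosureField P (a := P.x - 1) (by simp [thetaClosureRadicands]) ?_
  rw [map_sub, map_one]; exact hz

/-- The Legendre curve of `λ` over `F̄_tpd`, as a literal Weierstrass equation. [cite: MochizukiGenEll2010, Rmk 4.4.2 p.24] -/
theorem legendreCurve_baseChange_eq :
    P.legendreCurve.baseChange (AlgebraicClosure P.F) =
      ⟨0, -(1 + algebraMap P.F (AlgebraicClosure P.F) P.x), 0, algebraMap P.F (AlgebraicClosure P.F) P.x, 0⟩ := by
  ext <;> simp [WeierstrassCurve.baseChange, WeierstrassCurve.map]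

/-- **`λ` is good**: both square roots of `λ`, `λ − 1` and all `15`-torsion coordinates of `E_λ(F̄_tpd)` lie in
`F‡` (the construction of `F‡`). [claim: Mochizuki2012, status: disputed] -/
theorem good_lambda :
    (∀ z : AlgebraicClosure P.F, z ^ 2 = algebraMap P.F _ P.x → z ∈ thetaClosureField P) ∧
    (∀ z : AlgebraicClosure P.F, z ^ 2 = algebraMap P.F _ P.x - 1 → z ∈ thetaClosureField P) ∧
    (∀ T : (⟨0, -(1 + algebraMap P.F (AlgebraicClosure P.F) P.x), 0,
        algebraMap P.F (AlgebraicClosure P.F) P.x, 0⟩ : WeierstrassCurve (AlgebraicClosure P.F)).toAffine.Point,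
      (15 : ℤ) • T = 0 → ∀ z ∈ pointCoords T, z ∈ thetaClosureField P) := by
  refine ⟨fun z hz => sqrt_lambda_mem P hz, fun z hz => sqrt_lambda_sub_one_mem P hz, ?_⟩
  rw [← legendreCurve_baseChange_eq P]
  intro T hT z hz
  exact coords_mem_thetaClosureField P hT hz

/-- Transport of goodness along a change of variables `C • E_μ = E_{μ'}` whose coefficients `u⁻¹, r, s, t` lie
in `F‡`: every `15`-torsion point of `E_{μ'}` is the image of one of `E_μ`, with coordinates
`u⁻²(x − r)`, `u⁻³(y − s(x−r) − t)`. [cite: SilvermanAEC2009, III.§1 (admissible changes of variables)] -/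
theorem coords_mem_of_variableChange {μ μ' : AlgebraicClosure P.F} (C : VariableChange (AlgebraicClosure P.F))
    (hC : C • (⟨0, -(1 + μ), 0, μ, 0⟩ : WeierstrassCurve (AlgebraicClosure P.F)) = ⟨0, -(1 + μ'), 0, μ', 0⟩)
    (hu : (↑C.u⁻¹ : AlgebraicClosure P.F) ∈ thetaClosureField P) (hr : C.r ∈ thetaClosureField P)
    (hs : C.s ∈ thetaClosureField P) (ht : C.t ∈ thetaClosureField P)
    (hgood : ∀ T : (⟨0, -(1 + μ), 0, μ, 0⟩ : WeierstrassCurve (AlgebraicClosure P.F)).toAffine.Point,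
      (15 : ℤ) • T = 0 → ∀ z ∈ pointCoords T, z ∈ thetaClosureField P) :
    ∀ T : (⟨0, -(1 + μ'), 0, μ', 0⟩ : WeierstrassCurve (AlgebraicClosure P.F)).toAffine.Point,
      (15 : ℤ) • T = 0 → ∀ z ∈ pointCoords T, z ∈ thetaClosureField P := by
  set W : WeierstrassCurve (AlgebraicClosure P.F) := ⟨0, -(1 + μ), 0, μ, 0⟩ with hW
  let ψ : W.toAffine.Point ≃+ (⟨0, -(1 + μ'), 0, μ', 0⟩ : WeierstrassCurve _).toAffine.Point :=
    (VariableChange.pointEquiv W C).trans (Affine.Point.congrEquiv hC)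
  intro T hT z hz
  set T₀ := ψ.symm T with hT₀def
  have hT₀ : (15 : ℤ) • T₀ = 0 := by rw [hT₀def, ← map_zsmul, hT, map_zero]
  have hTψ : T = ψ T₀ := (ψ.apply_symm_apply T).symm
  rcases hT₀cases : T₀ with _ | ⟨x, y, hxy⟩
  · rw [hT₀cases] at hTψ
    have h0 : ψ Affine.Point.zero = 0 := map_zero ψ
    rw [hTψ, h0] at hz
    simp [pointCoords] at hz
  · have hx : x ∈ thetaClosureField P := hgood T₀ hT₀ x (by rw [hT₀cases]; simp [pointCoords])
    have hy : y ∈ thetaClosureField P := hgood T₀ hT₀ y (by rw [hT₀cases]; simp [pointCoords])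
    have himg : ψ (.some x y hxy) = .some (C.toX x) (C.toY x y)
        (hC ▸ (VariableChange.nonsingular_iff W C x y).mpr hxy) := by
      show Affine.Point.congrEquiv hC (VariableChange.pointEquiv W C (.some x y hxy)) = _
      rw [VariableChange.pointEquiv_some, Affine.Point.congrEquiv_some]
    rw [hT₀cases] at hTψ
    rw [hTψ, himg] at hz
    simp only [pointCoords, Set.mem_insert_iff, Set.mem_singleton_iff] at hz
    rcases hz with rfl | rfl
    · rw [VariableChange.toX_def]
      exact mul_mem (pow_mem hu 2) (sub_mem hx hr)
    · rw [VariableChange.toY_def]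
      exact mul_mem (pow_mem hu 3) (sub_mem (sub_mem hy (mul_mem hs (sub_mem hx hr))) ht)

/-- **Goodness passes from `μ` to `1 − μ`** (`E_{1−μ} ≅ E_μ^{(−1)}` over `F‡ ∋ √−1`; `√(1−μ) = √−1·√(μ−1)`,
`√((1−μ)−1) = √−1·√μ`). [cite: MochizukiGenEll2010, Rmk 4.4.2 p.24] -/
theorem good_one_sub {μ : AlgebraicClosure P.F}
    (h : (∀ z : AlgebraicClosure P.F, z ^ 2 = μ → z ∈ thetaClosureField P) ∧
      (∀ z : AlgebraicClosure P.F, z ^ 2 = μ - 1 → z ∈ thetaClosureField P) ∧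
      (∀ T : (⟨0, -(1 + μ), 0, μ, 0⟩ : WeierstrassCurve (AlgebraicClosure P.F)).toAffine.Point,
        (15 : ℤ) • T = 0 → ∀ z ∈ pointCoords T, z ∈ thetaClosureField P)) :
    (∀ z : AlgebraicClosure P.F, z ^ 2 = (1 - μ) → z ∈ thetaClosureField P) ∧
      (∀ z : AlgebraicClosure P.F, z ^ 2 = (1 - μ) - 1 → z ∈ thetaClosureField P) ∧
      (∀ T : (⟨0, -(1 + (1 - μ)), 0, 1 - μ, 0⟩ : WeierstrassCurve (AlgebraicClosure P.F)).toAffine.Point,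
        (15 : ℤ) • T = 0 → ∀ z ∈ pointCoords T, z ∈ thetaClosureField P) := by
  obtain ⟨i, hi⟩ : ∃ i : AlgebraicClosure P.F, i ^ 2 = -1 := IsAlgClosed.exists_pow_nat_eq _ two_pos
  have hi0 : i ≠ 0 := by intro h0; rw [h0] at hi; norm_num at hi
  have hiF : i ∈ thetaClosureField P := sqrt_neg_one_mem P hi
  obtain ⟨hμ, hμ1, hT⟩ := h
  refine ⟨fun z hz => ?_, fun z hz => ?_, ?_⟩
  · -- `(z i)² = μ − 1`
    have hzi : (z * i) ^ 2 = μ - 1 := by rw [mul_pow, hz, hi]; ring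
    have := hμ1 _ hzi
    have hz' : z = z * i * i⁻¹ := by rw [mul_assoc, mul_inv_cancel₀ hi0, mul_one]
    rw [hz']
    exact mul_mem this (inv_mem hiF)
  · -- `(z i)² = μ`
    have hzi : (z * i) ^ 2 = μ := by rw [mul_pow, hz, hi]; ring
    have := hμ _ hzi
    have hz' : z = z * i * i⁻¹ := by rw [mul_assoc, mul_inv_cancel₀ hi0, mul_one]
    rw [hz']
    exact mul_mem this (inv_mem hiF)
  · refine coords_mem_of_variableChange P ⟨Units.mk0 i hi0, 1, 0, 0⟩
      (variableChange_legendre_one_sub μ hi) ?_ (one_mem _) (zero_mem _) (zero_mem _) hT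
    simp only [Units.val_inv_eq_inv_val, Units.val_mk0]
    exact inv_mem hiF

/-- **Goodness passes from `μ ≠ 0` to `1/μ`** (`E_{1/μ} ≅ E_μ^{(μ)}` over `F‡ ∋ √μ`; `√(1/μ) = 1/√μ`,
`√(1/μ − 1) = √−1·√(μ−1)/√μ`). [cite: MochizukiGenEll2010, Rmk 4.4.2 p.24] -/
theorem good_inv {μ : AlgebraicClosure P.F} (hμ0 : μ ≠ 0)
    (h : (∀ z : AlgebraicClosure P.F, z ^ 2 = μ → z ∈ thetaClosureField P) ∧
      (∀ z : AlgebraicClosure P.F, z ^ 2 = μ - 1 → z ∈ thetaClosureField P) ∧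
      (∀ T : (⟨0, -(1 + μ), 0, μ, 0⟩ : WeierstrassCurve (AlgebraicClosure P.F)).toAffine.Point,
        (15 : ℤ) • T = 0 → ∀ z ∈ pointCoords T, z ∈ thetaClosureField P)) :
    (∀ z : AlgebraicClosure P.F, z ^ 2 = μ⁻¹ → z ∈ thetaClosureField P) ∧
      (∀ z : AlgebraicClosure P.F, z ^ 2 = μ⁻¹ - 1 → z ∈ thetaClosureField P) ∧
      (∀ T : (⟨0, -(1 + μ⁻¹), 0, μ⁻¹, 0⟩ : WeierstrassCurve (AlgebraicClosure P.F)).toAffine.Point,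
        (15 : ℤ) • T = 0 → ∀ z ∈ pointCoords T, z ∈ thetaClosureField P) := by
  obtain ⟨i, hi⟩ : ∃ i : AlgebraicClosure P.F, i ^ 2 = -1 := IsAlgClosed.exists_pow_nat_eq _ two_pos
  have hi0 : i ≠ 0 := by intro h0; rw [h0] at hi; norm_num at hi
  have hiF : i ∈ thetaClosureField P := sqrt_neg_one_mem P hi
  obtain ⟨w, hw⟩ : ∃ w : AlgebraicClosure P.F, w ^ 2 = μ := IsAlgClosed.exists_pow_nat_eq _ two_pos
  have hw0 : w ≠ 0 := by intro h0; rw [h0] at hw; exact hμ0 (by rw [← hw]; norm_num)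
  obtain ⟨hμ, hμ1, hT⟩ := h
  have hwF : w ∈ thetaClosureField P := hμ w hw
  refine ⟨fun z hz => ?_, fun z hz => ?_, ?_⟩
  · -- `(z w)² = 1`, so `z = ± 1/w`
    have hzw : (z * w) ^ 2 = 1 ^ 2 := by rw [mul_pow, hz, hw, inv_mul_cancel₀ hμ0, one_pow]
    have hz' : z = z * w * w⁻¹ := by rw [mul_assoc, mul_inv_cancel₀ hw0, mul_one]
    rw [hz']
    refine mul_mem ?_ (inv_mem hwF)
    rcases sq_eq_sq_iff_eq_or_eq_neg.1 hzw with h1 | h1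
    · rw [h1]; exact one_mem _
    · rw [h1]; exact neg_mem (one_mem _)
  · -- `(z w i)² = μ − 1`
    have hzwi : (z * w * i) ^ 2 = μ - 1 := by
      rw [mul_pow, mul_pow, hz, hw, hi]
      field_simp
      ring
    have := hμ1 _ hzwi
    have hz' : z = z * w * i * (i⁻¹ * w⁻¹) := by
      field_simp
    rw [hz']
    exact mul_mem this (mul_mem (inv_mem hiF) (inv_mem hwF))
  · refine coords_mem_of_variableChange P ⟨Units.mk0 w hw0, 0, 0, 0⟩
      (variableChange_legendre_inv μ hw hμ0) ?_ (zero_mem _) (zero_mem _) (zero_mem _) hT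
    simp only [Units.val_inv_eq_inv_val, Units.val_mk0]
    exact inv_mem hwF

/-- **Goodness on the whole anharmonic orbit of `λ`.** [cite: MochizukiGenEll2010, Rmk 4.4.2 p.24] -/
theorem good_of_mem_anharmonicSet (hU : P.InU) {μ : AlgebraicClosure P.F}
    (hμ : μ ∈ NFPoint.anharmonicSet (algebraMap P.F (AlgebraicClosure P.F) P.x)) :
    (∀ z : AlgebraicClosure P.F, z ^ 2 = μ → z ∈ thetaClosureField P) ∧
      (∀ z : AlgebraicClosure P.F, z ^ 2 = μ - 1 → z ∈ thetaClosureField P) ∧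
      (∀ T : (⟨0, -(1 + μ), 0, μ, 0⟩ : WeierstrassCurve (AlgebraicClosure P.F)).toAffine.Point,
        (15 : ℤ) • T = 0 → ∀ z ∈ pointCoords T, z ∈ thetaClosureField P) := by
  set la := algebraMap P.F (AlgebraicClosure P.F) P.x with hla
  have h0 : la ≠ 0 := by rw [hla]; exact (map_ne_zero _).2 hU.1
  have h1 : la ≠ 1 := by
    rw [hla]; intro h; exact hU.2 ((map_eq_one_iff _ (algebraMap P.F _).injective).1 h)
  have h1' : 1 - la ≠ 0 := sub_ne_zero.2 (Ne.symm h1)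
  have gla := good_lambda P
  simp only [NFPoint.anharmonicSet, Set.mem_insert_iff, Set.mem_singleton_iff] at hμ
  rcases hμ with rfl | rfl | rfl | rfl | rfl | rfl
  · exact gla
  · exact good_inv P h0 gla
  · exact good_one_sub P gla
  · exact good_inv P h1' (good_one_sub P gla)
  · have e : la / (la - 1) = 1 - (1 - la)⁻¹ := by
      field_simp
      ring
    rw [e]
    exact good_one_sub P (good_inv P h1' (good_one_sub P gla))
  · have e : (la - 1) / la = 1 - la⁻¹ := by field_simp
    rw [e]
    exact good_one_sub P (good_inv P h0 gla)

end Orbit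

end Cor22

end Literature.IUT.LogVolume

end
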